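import Summits.QuantumFields.BalabanUV.T4Continuum.Support.DirichletDipCutoffCorner
import Summits.QuantumFields.BalabanUV.T4Continuum.Support.DirichletRelativeBesovIntrinsic

/-!
# `BalabanUV.T4Continuum.Support.DirichletDipCutoffSmooth` — NE2 (node U1a) formalisation swarm, sub-row `T4-U1a.S-NE2-D1-DIRICHLET°`, supplier item
# «Δ1-SKELETON» (file 7): THE GENERIC CUTOFF `ψ_μ = Π_β (1 − dip_β)` IS Ω-INTRINSICALLY SMOOTH AWAY FROM THE BOTTOM CORNER CELLS — for every
# block set `S`, every axis `μ`, every `d`, every torus: `RelSmoothIn (blockReg S) z ψ_μ ℓ₁ ℓ₂` with `ℓ₁ = 6·3^d·lip1 R`,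
# `ℓ₂ = 6·3^d·lip2 R + 2ℓ₁²` for every field `z` whose support keeps distance `1` from the `NearCorner` sets of the `−μ`-exposed blocks
# (unit b2b-balaban-t4-ne2-formalise-leaf-08, gen 7, file 7)

HONEST FRAMING.  Rung (B)+1 bookkeeping at MODEL level, finite torus; pure lattice combinatorics; NE2 (U1a) is NOT proved by this file;
spine PROVED 0/9 unchanged; NOT infinite volume, NOT the mass gap, NOT Clay.  HONEST DEPENDENCY (verbatim): «continuum YM on T⁴ ⇐ BetaPertH ∧
nine spine estimates (0/9 proved); BetaPertH ⇐ (D1) ∧ (D4) ∧ CAP+tail; G-an2-4 gates asym, D1 and NE2/3/4.»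

WHAT THIS FILE PROVES (0 sorry).  §1 the transversal dip lemmas **`dip_step_tr`**, **`dip_second_tr`** (`κ ≠ μ`; centre not `NearCorner β`;
file 6's corner lemma + the propagation of `Gs = 0` across a face).  §2 the ACTIVE SET `Aset x` (the `3^d` blocks within one block step of the
block of `x`, shifted pattern `{−1, 0, +1}^d`) with `dip_β x ≠ 0 → β ∈ Aset x`.  §3 **`psiS_relSmoothIn`**: file 1's intrinsic smoothness
structure for `psiS` w.r.t. any field `z` such that `z x ≠ 0 ∨ z(x ± e_ν) ≠ 0` forces `x, x ± e_ν ∉ NearCorner β` for every `−μ`-exposed `β`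
(file 2's product rules; only the `≤ 3·3^d` active factors contribute).  Together with file 3's exact boundary values this makes `psiS` an
admissible `μ`-cutoff, in the sense of file 1's END `nsq_sdiffH_sdiff_le_in`, for every field supported in `Ω` minus the `1`-neighbourhood
of the corner cells — the input of the cut-out assembly (next files).

ABSOLUTE RULE (cell, verbatim): «No internally-minted statement may enter as a cited fact. Every hypothesis is either kernel-proved in
this package or a verbatim quotation of a PUBLISHED theorem with page reference. The manuscript(s) under audit are NOT citable for
their own disputed steps — they are the thing under adjudication; programme-internal (2001/route/tribunal) claims are never citable.»
[folklore] lattice bookkeeping; data definitions `Aset`, `ell1`, `ell2`; no `def … : Prop` fact.  NOT CLAIMED: the cut-out set and its indicator,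
the two-level law; NE2; NE3.
-/

noncomputable section

open scoped BigOperators
open Finset

namespace Summit.QuantumFields.BalabanUV.T4Continuum.DirichletDipCutoffSmooth

open Literature.MathematicalPhysics.QuantumFieldTheory.Balaban1983to89.B5Prop11Plancherel (Tor fine unitVec)
open Literature.MathematicalPhysics.QuantumFieldTheory.Balaban1983to89.B5Blocks16 (blockOf)
open Summit.QuantumFields.BalabanUV.Beta.GAN24.DirichletBoxTrace (blockReg)
open Summit.QuantumFields.BalabanUV.T4Continuum.DirichletMonotoneCutoff (offsF blockOf_offsF_add_of_lt blockOf_offsF_add_of_eq blockOf_offsF_sub)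
open Summit.QuantumFields.BalabanUV.T4Continuum.ScaleProfile (lip1 lip2 lip1_nonneg lip2_nonneg abs_prod_sub_prod_le abs_prod_second_le
  sum_le_card_mul)
open Summit.QuantumFields.BalabanUV.T4Continuum.DirichletDipCutoff (BotExp hV Wax Ptr conn Gs dip psiS conn_mem dip_mem one_sub_dip_mem
  Gs_eq_of_botExp Gs_eq_zero_of_not_botExp hV_eq_zero_of_far Wax_eq_zero_of_far conn_eq_one_of_up dip_eq_zero_of_not_botExp)
open Summit.QuantumFields.BalabanUV.T4Continuum.DirichletDipCutoffAxis (add_unitVec_self add_unitVec_ne sub_unitVec_self sub_unitVec_ne Gs_cross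
  Gs_step Gs_second)
open Summit.QuantumFields.BalabanUV.T4Continuum.DirichletDipCutoffCorner (NearCorner nearCorner_of_lower_cross Gs_prev_eq_zero Gs_next_eq_zero
  dip_step_mu dip_second_mu abs_sub_mul_le)
open Summit.QuantumFields.BalabanUV.T4Continuum.DirichletRelativeBesovIntrinsic (RelSmoothIn)

variable {d : ℕ} (n : ℕ) [NeZero n] (M : Fin d → ℕ) [hM : ∀ μ, NeZero (M μ)]

/-! ## §1 The dips along a transversal axis -/

section Tr

variable {n M} {S : Tor M → Prop} [DecidablePred S] {μ : Fin d} {R : ℕ} (hR : 2 ≤ R) (hn : 4 * R ≤ n) (β : Tor M)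
include hR hn

/-- at a transversal face crossing inside `Ω` away from the corners, a non-zero smooth part forces the UPPER layer. [folklore] -/
theorem upper_of_cross {κ : Fin d} (hκ : κ ≠ μ) {x : Tor (fine n M)} (hr : (offsF n M x κ : ℕ) + 1 = n) (hx : blockReg n M S x)
    (hy : blockReg n M S (x + unitVec (fine n M) κ)) (hnc : ¬ NearCorner n M μ R β x ∨ ¬ NearCorner n M μ R β (x + unitVec (fine n M) κ))
    (hG : Gs n M S μ R β x ≠ 0) : blockOf n M x μ = β μ := by
  have hBE : BotExp M S μ β := by by_contra h; exact hG (Gs_eq_zero_of_not_botExp h _)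
  by_contra h1
  by_cases h2 : blockOf n M x μ = β μ - 1
  · have := nearCorner_of_lower_cross hR hn hBE hκ hr hx hy h2 hG
    exact hnc.elim (fun h => h this.1) (fun h => h this.2)
  · exact hG (by rw [Gs_eq_of_botExp hBE, hV_eq_zero_of_far h1 h2, zero_mul])

/-- **dip steps along `κ ≠ μ`** inside `Ω`, centre not near a corner: `≤ 2·lip1 R`. [folklore] -/
theorem dip_step_tr {κ : Fin d} (hκ : κ ≠ μ) {x : Tor (fine n M)} (hx : blockReg n M S x) (hy : blockReg n M S (x + unitVec (fine n M) κ))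
    (hnc : ¬ NearCorner n M μ R β x) : |dip n M S μ R β (x + unitVec (fine n M) κ) - dip n M S μ R β x| ≤ 2 * lip1 R := by
  have hl1 := lip1_nonneg hR
  unfold dip
  rcases Nat.lt_or_ge ((offsF n M x κ : ℕ) + 1) n with hlt | hge
  · obtain ⟨hb, -⟩ := blockOf_offsF_add_of_lt n M x κ hlt
    have hc : conn n M S μ β (x + unitVec (fine n M) κ) = conn n M S μ β x := by unfold conn; rw [hb]
    rw [hc]
    have hcm := conn_mem (n := n) (S := S) (μ := μ) β x
    exact (abs_sub_mul_le hcm.1 hcm.2).trans (Gs_step hR hn β κ x)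
  · have heq : (offsF n M x κ : ℕ) + 1 = n := le_antisymm (offsF n M x κ).isLt hge
    obtain ⟨hb, -⟩ := blockOf_offsF_add_of_eq n M x κ heq
    rw [Gs_cross hR hn β κ heq]
    by_cases hG : Gs n M S μ R β x = 0
    · rw [hG]; simp; positivity
    · have hup := upper_of_cross hR hn β hκ heq hx hy (Or.inl hnc) hG
      rw [conn_eq_one_of_up hup, conn_eq_one_of_up (by rw [hb, add_unitVec_ne M _ (Ne.symm hκ)]; exact hup), sub_self, abs_zero]
      positivity

/-- **dip second differences along `κ ≠ μ`** inside `Ω`, centre not near a corner: `≤ 2·lip2 R`. [folklore] -/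
theorem dip_second_tr {κ : Fin d} (hκ : κ ≠ μ) {x : Tor (fine n M)} (hx : blockReg n M S x) (hp : blockReg n M S (x + unitVec (fine n M) κ))
    (hm : blockReg n M S (x - unitVec (fine n M) κ)) (hnc : ¬ NearCorner n M μ R β x) :
    |2 * dip n M S μ R β x - dip n M S μ R β (x + unitVec (fine n M) κ) - dip n M S μ R β (x - unitVec (fine n M) κ)| ≤ 2 * lip2 R := by
  have hl2 : 0 ≤ lip2 R := lip2_nonneg
  have h2l : (0 : ℝ) ≤ 2 * lip2 R := by positivity
  unfold dip
  rcases blockOf_offsF_sub n M x κ with ⟨hne, hbm, hom, -⟩ | ⟨h0, hbm, hom, -⟩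
  · have hc2 : conn n M S μ β (x - unitVec (fine n M) κ) = conn n M S μ β x := by unfold conn; rw [hbm]
    rcases Nat.lt_or_ge ((offsF n M x κ : ℕ) + 1) n with hlt | hge
    · obtain ⟨hb, -⟩ := blockOf_offsF_add_of_lt n M x κ hlt
      have hc1 : conn n M S μ β (x + unitVec (fine n M) κ) = conn n M S μ β x := by unfold conn; rw [hb]
      rw [hc1, hc2]
      have hcm := conn_mem (n := n) (S := S) (μ := μ) β x
      calc |2 * (Gs n M S μ R β x * conn n M S μ β x) - Gs n M S μ R β (x + unitVec (fine n M) κ) * conn n M S μ β x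
              - Gs n M S μ R β (x - unitVec (fine n M) κ) * conn n M S μ β x|
          = |conn n M S μ β x| * |2 * Gs n M S μ R β x - Gs n M S μ R β (x + unitVec (fine n M) κ) - Gs n M S μ R β (x - unitVec (fine n M) κ)| := by
            rw [← abs_mul]; congr 1; ring
        _ ≤ 1 * _ := mul_le_mul_of_nonneg_right (by rw [abs_of_nonneg hcm.1]; exact hcm.2) (abs_nonneg _)
        _ ≤ 2 * lip2 R := by rw [one_mul]; exact Gs_second hR hn β κ x
    · have heq : (offsF n M x κ : ℕ) + 1 = n := le_antisymm (offsF n M x κ).isLt hge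
      obtain ⟨hb, -⟩ := blockOf_offsF_add_of_eq n M x κ heq
      rw [Gs_cross hR hn β κ heq, hc2]
      by_cases hG : Gs n M S μ R β x = 0
      · rw [hG, Gs_prev_eq_zero hR hn hκ heq hG]; simp; positivity
      · have hup := upper_of_cross hR hn β hκ heq hx hp (Or.inl hnc) hG
        have c0 : conn n M S μ β x = 1 := conn_eq_one_of_up hup
        have c1 : conn n M S μ β (x + unitVec (fine n M) κ) = 1 := conn_eq_one_of_up (by rw [hb, add_unitVec_ne M _ (Ne.symm hκ)]; exact hup)
        simp only [c0, c1, mul_one]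
        have := Gs_second (S := S) (μ := μ) hR hn β κ x
        rw [Gs_cross hR hn β κ heq] at this; exact this
  · -- offset `0`: the backward bond crosses the face below
    have hlt : (offsF n M x κ : ℕ) + 1 < n := by omega
    obtain ⟨hb, -⟩ := blockOf_offsF_add_of_lt n M x κ hlt
    have hc1 : conn n M S μ β (x + unitVec (fine n M) κ) = conn n M S μ β x := by unfold conn; rw [hb]
    have hr' : (offsF n M (x - unitVec (fine n M) κ) κ : ℕ) + 1 = n := by rw [hom]; omega
    have hcr : Gs n M S μ R β x = Gs n M S μ R β (x - unitVec (fine n M) κ) := by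
      have := Gs_cross hR hn (S := S) (μ := μ) (R := R) β κ (x := x - unitVec (fine n M) κ) hr'
      rw [sub_add_cancel] at this; exact this
    rw [hc1]
    by_cases hG : Gs n M S μ R β x = 0
    · rw [hG, Gs_next_eq_zero hR hn hκ h0 hG, ← hcr, hG]; simp; positivity
    · have hG' : Gs n M S μ R β (x - unitVec (fine n M) κ) ≠ 0 := by rwa [← hcr]
      have hup' := upper_of_cross hR hn β hκ hr' hm (by rw [sub_add_cancel]; exact hx) (Or.inr (by rw [sub_add_cancel]; exact hnc)) hG'
      have hup : blockOf n M x μ = β μ := by rw [hbm, sub_unitVec_ne M _ (Ne.symm hκ)] at hup'; exact hup'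
      have c0 : conn n M S μ β x = 1 := conn_eq_one_of_up hup
      have c2 : conn n M S μ β (x - unitVec (fine n M) κ) = 1 := conn_eq_one_of_up hup'
      simp only [c0, c2, mul_one]
      exact Gs_second hR hn β κ x

/-- **dip steps along any axis** (both cases). [folklore] -/
theorem dip_step (κ : Fin d) {x : Tor (fine n M)} (hx : blockReg n M S x) (hy : blockReg n M S (x + unitVec (fine n M) κ))
    (hnc : ¬ NearCorner n M μ R β x) : |dip n M S μ R β (x + unitVec (fine n M) κ) - dip n M S μ R β x| ≤ 2 * lip1 R := by
  by_cases hκ : κ = μ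
  · subst hκ; exact dip_step_mu hR hn β hy
  · exact dip_step_tr hR hn β hκ hx hy hnc

/-- **dip second differences along any axis** (both cases). [folklore] -/
theorem dip_second (κ : Fin d) {x : Tor (fine n M)} (hx : blockReg n M S x) (hp : blockReg n M S (x + unitVec (fine n M) κ))
    (hm : blockReg n M S (x - unitVec (fine n M) κ)) (hnc : ¬ NearCorner n M μ R β x) :
    |2 * dip n M S μ R β x - dip n M S μ R β (x + unitVec (fine n M) κ) - dip n M S μ R β (x - unitVec (fine n M) κ)| ≤ 2 * lip2 R := by
  by_cases hκ : κ = μ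
  · subst hκ; exact dip_second_mu hR hn β hx hp
  · exact dip_second_tr hR hn β hκ hx hp hm hnc

end Tr

/-! ## §2 The active set of a site -/

/-- the `3^d` blocks whose coordinates are within one step of those of the block of `x`. [folklore] -/
def Aset (x : Tor (fine n M)) : Finset (Tor M) :=
  univ.image fun δ : Fin d → Fin 3 => fun ν => blockOf n M x ν + ((((δ ν : ℕ) : ZMod (M ν))) - 1)

/-- `card (Aset x) ≤ 3^d`. [folklore] -/
theorem card_Aset_le (x : Tor (fine n M)) : (Aset n M x).card ≤ 3 ^ d :=
  Finset.card_image_le.trans (by simp [Fintype.card_pi])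

section Active

variable {n M} {S : Tor M → Prop} [DecidablePred S] {μ : Fin d} {R : ℕ}

/-- **a non-zero dip comes from an active block.** [folklore] -/
theorem mem_Aset_of_dip_ne_zero {β : Tor M} {x : Tor (fine n M)} (h : dip n M S μ R β x ≠ 0) : β ∈ Aset n M x := by
  have hBE : BotExp M S μ β := by by_contra h'; exact h (dip_eq_zero_of_not_botExp h' _)
  have hG : Gs n M S μ R β x ≠ 0 := fun h' => h (by unfold dip; rw [h', zero_mul])
  rw [Gs_eq_of_botExp hBE] at hG
  have hV0 : hV n M μ R β x ≠ 0 := fun h' => hG (by rw [h', zero_mul])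
  have hP0 : Ptr n M μ R β x ≠ 0 := fun h' => hG (by rw [h', mul_zero])
  have hμ : blockOf n M x μ = β μ ∨ blockOf n M x μ = β μ - 1 := by
    by_contra h'; push Not at h'; exact hV0 (hV_eq_zero_of_far h'.1 h'.2)
  have htr : ∀ lam, lam ≠ μ → blockOf n M x lam = β lam ∨ blockOf n M x lam = β lam + 1 ∨ blockOf n M x lam = β lam - 1 := by
    intro lam hl
    by_contra h'; push Not at h'
    exact (Finset.prod_ne_zero_iff.mp hP0) lam (Finset.mem_erase.mpr ⟨hl, Finset.mem_univ _⟩) (Wax_eq_zero_of_far h'.1 h'.2.1 h'.2.2)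
  classical
  refine Finset.mem_image.mpr ⟨fun ν => (if β ν = blockOf n M x ν then 1 else if β ν = blockOf n M x ν + 1 then 2 else 0 : Fin 3),
    Finset.mem_univ _, ?_⟩
  funext ν
  dsimp only
  by_cases h1 : β ν = blockOf n M x ν
  · rw [if_pos h1, Fin.val_one, Nat.cast_one, h1]; ring
  · by_cases h2 : β ν = blockOf n M x ν + 1
    · rw [if_neg h1, if_pos h2, Fin.val_two, Nat.cast_ofNat, h2]; ring
    · rw [if_neg h1, if_neg h2, Fin.val_zero, Nat.cast_zero]
      -- the remaining possibility is `β ν = blockOf x ν − 1`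
      have h3 : β ν = blockOf n M x ν - 1 := by
        by_cases hν : ν = μ
        · subst hν
          rcases hμ with h | h
          · exact absurd h.symm h1
          · exact absurd (by rw [h, sub_add_cancel]) h2
        · rcases htr ν hν with h | h | h
          · exact absurd h.symm h1
          · rw [h, add_sub_cancel_right]
          · exact absurd (by rw [h, sub_add_cancel]) h2
      rw [h3]; ring

/-- off the active sets, the dip vanishes. [folklore] -/
theorem dip_eq_zero_of_not_mem {β : Tor M} {x : Tor (fine n M)} (h : β ∉ Aset n M x) : dip n M S μ R β x = 0 := by
  by_contra h'; exact h (mem_Aset_of_dip_ne_zero h')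

end Active

/-! ## §3 The intrinsic smoothness structure of `ψ_μ` -/

/-- the first-difference constant `ℓ₁ = 3·3^d·(2·lip1 R)`. [folklore] -/
def ell1 (d R : ℕ) : ℝ := 3 * 3 ^ d * (2 * lip1 R)

/-- the second-difference constant `ℓ₂ = 3·3^d·(2·lip2 R) + 2ℓ₁²`. [folklore] -/
def ell2 (d R : ℕ) : ℝ := 3 * 3 ^ d * (2 * lip2 R) + 2 * ell1 d R ^ 2

section Main

variable {n M} {S : Tor M → Prop} [DecidablePred S] {μ : Fin d} {R : ℕ} (hR : 2 ≤ R) (hn : 4 * R ≤ n)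
include hR hn

/-- the sum of the dip steps over all blocks, along an `Ω`-bond whose base is off the corners. [folklore] -/
theorem sum_abs_dip_step_le (κ : Fin d) {x : Tor (fine n M)} (hx : blockReg n M S x) (hy : blockReg n M S (x + unitVec (fine n M) κ))
    (hnc : ∀ β, BotExp M S μ β → ¬ NearCorner n M μ R β x) :
    ∑ β : Tor M, |(1 - dip n M S μ R β (x + unitVec (fine n M) κ)) - (1 - dip n M S μ R β x)| ≤ ell1 d R := by
  classical
  have hl1 := lip1_nonneg hR
  set A := Aset n M x ∪ Aset n M (x + unitVec (fine n M) κ) with hA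
  have hcard : (A.card : ℝ) ≤ 3 * 3 ^ d := by
    have h1 := card_Aset_le n M x
    have h2 := card_Aset_le n M (x + unitVec (fine n M) κ)
    have := (Finset.card_union_le _ _).trans (add_le_add h1 h2)
    have : (A.card : ℝ) ≤ ((3 ^ d + 3 ^ d : ℕ) : ℝ) := by exact_mod_cast this
    push_cast at this; linarith [show (0 : ℝ) ≤ 3 ^ d by positivity]
  rw [← Finset.sum_subset (Finset.subset_univ A) (fun β _ hβ => by
    rw [Finset.notMem_union] at hβ
    rw [dip_eq_zero_of_not_mem hβ.1, dip_eq_zero_of_not_mem hβ.2, sub_self, abs_zero])]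
  have hterm : ∀ β ∈ A, |(1 - dip n M S μ R β (x + unitVec (fine n M) κ)) - (1 - dip n M S μ R β x)| ≤ 2 * lip1 R := by
    intro β _
    rw [show (1 - dip n M S μ R β (x + unitVec (fine n M) κ)) - (1 - dip n M S μ R β x)
        = -(dip n M S μ R β (x + unitVec (fine n M) κ) - dip n M S μ R β x) by ring, abs_neg]
    by_cases hBE : BotExp M S μ β
    · exact dip_step hR hn β κ hx hy (hnc β hBE)
    · rw [dip_eq_zero_of_not_botExp hBE, dip_eq_zero_of_not_botExp hBE, sub_self, abs_zero]; positivity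
  calc ∑ β ∈ A, |(1 - dip n M S μ R β (x + unitVec (fine n M) κ)) - (1 - dip n M S μ R β x)|
      ≤ A.card * (2 * lip1 R) := sum_le_card_mul hterm
    _ ≤ 3 * 3 ^ d * (2 * lip1 R) := mul_le_mul_of_nonneg_right hcard (by positivity)

/-- the sum of the dip second differences over all blocks, along an `Ω`-triple whose centre is off the corners. [folklore] -/
theorem sum_abs_dip_second_le (κ : Fin d) {x : Tor (fine n M)} (hx : blockReg n M S x) (hp : blockReg n M S (x + unitVec (fine n M) κ))
    (hm : blockReg n M S (x - unitVec (fine n M) κ)) (hnc : ∀ β, BotExp M S μ β → ¬ NearCorner n M μ R β x) :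
    ∑ β : Tor M, |(1 - dip n M S μ R β (x + unitVec (fine n M) κ)) + (1 - dip n M S μ R β (x - unitVec (fine n M) κ))
        - 2 * (1 - dip n M S μ R β x)| ≤ 3 * 3 ^ d * (2 * lip2 R) := by
  classical
  have hl2 : 0 ≤ lip2 R := lip2_nonneg
  set A := Aset n M x ∪ Aset n M (x + unitVec (fine n M) κ) ∪ Aset n M (x - unitVec (fine n M) κ) with hA
  have hcard : (A.card : ℝ) ≤ 3 * 3 ^ d := by
    have h1 := card_Aset_le n M x
    have h2 := card_Aset_le n M (x + unitVec (fine n M) κ)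
    have h3 := card_Aset_le n M (x - unitVec (fine n M) κ)
    have := ((Finset.card_union_le _ _).trans (add_le_add ((Finset.card_union_le _ _).trans (add_le_add h1 h2)) h3))
    have : (A.card : ℝ) ≤ ((3 ^ d + 3 ^ d + 3 ^ d : ℕ) : ℝ) := by exact_mod_cast this
    push_cast at this; linarith
  rw [← Finset.sum_subset (Finset.subset_univ A) (fun β _ hβ => by
    rw [Finset.notMem_union, Finset.notMem_union] at hβ
    rw [dip_eq_zero_of_not_mem hβ.1.1, dip_eq_zero_of_not_mem hβ.1.2, dip_eq_zero_of_not_mem hβ.2]; norm_num)]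
  have hterm : ∀ β ∈ A, |(1 - dip n M S μ R β (x + unitVec (fine n M) κ)) + (1 - dip n M S μ R β (x - unitVec (fine n M) κ))
      - 2 * (1 - dip n M S μ R β x)| ≤ 2 * lip2 R := by
    intro β _
    rw [show (1 - dip n M S μ R β (x + unitVec (fine n M) κ)) + (1 - dip n M S μ R β (x - unitVec (fine n M) κ)) - 2 * (1 - dip n M S μ R β x)
        = 2 * dip n M S μ R β x - dip n M S μ R β (x + unitVec (fine n M) κ) - dip n M S μ R β (x - unitVec (fine n M) κ) by ring]
    by_cases hBE : BotExp M S μ β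
    · exact dip_second hR hn β κ hx hp hm (hnc β hBE)
    · rw [dip_eq_zero_of_not_botExp hBE, dip_eq_zero_of_not_botExp hBE, dip_eq_zero_of_not_botExp hBE]; norm_num; positivity
  calc ∑ β ∈ A, |(1 - dip n M S μ R β (x + unitVec (fine n M) κ)) + (1 - dip n M S μ R β (x - unitVec (fine n M) κ)) - 2 * (1 - dip n M S μ R β x)|
      ≤ A.card * (2 * lip2 R) := sum_le_card_mul hterm
    _ ≤ 3 * 3 ^ d * (2 * lip2 R) := mul_le_mul_of_nonneg_right hcard (by positivity)

/-- **`ψ_μ` first differences along an `Ω`-bond off the corners: `≤ ℓ₁`.** [folklore] -/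
theorem psiS_step (κ : Fin d) {x : Tor (fine n M)} (hx : blockReg n M S x) (hy : blockReg n M S (x + unitVec (fine n M) κ))
    (hnc : ∀ β, BotExp M S μ β → ¬ NearCorner n M μ R β x) :
    |psiS n M S μ R (x + unitVec (fine n M) κ) - psiS n M S μ R x| ≤ ell1 d R := by
  unfold psiS
  refine (abs_prod_sub_prod_le _ (fun β _ => one_sub_dip_mem hR hn β _) (fun β _ => one_sub_dip_mem hR hn β _)).trans ?_
  exact sum_abs_dip_step_le hR hn κ hx hy hnc

/-- **`ψ_μ` second differences along an `Ω`-triple off the corners: `≤ ℓ₂`.** [folklore] -/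
theorem psiS_second (κ : Fin d) {x : Tor (fine n M)} (hx : blockReg n M S x) (hp : blockReg n M S (x + unitVec (fine n M) κ))
    (hm : blockReg n M S (x - unitVec (fine n M) κ)) (hnc : ∀ β, BotExp M S μ β → ¬ NearCorner n M μ R β x)
    (hncm : ∀ β, BotExp M S μ β → ¬ NearCorner n M μ R β (x - unitVec (fine n M) κ)) :
    |2 * psiS n M S μ R x - psiS n M S μ R (x + unitVec (fine n M) κ) - psiS n M S μ R (x - unitVec (fine n M) κ)| ≤ ell2 d R := by
  have hl1 := lip1_nonneg hR
  unfold psiS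
  rw [show 2 * ∏ β : Tor M, (1 - dip n M S μ R β x) - ∏ β : Tor M, (1 - dip n M S μ R β (x + unitVec (fine n M) κ))
        - ∏ β : Tor M, (1 - dip n M S μ R β (x - unitVec (fine n M) κ))
      = -(∏ β : Tor M, (1 - dip n M S μ R β (x + unitVec (fine n M) κ)) + ∏ β : Tor M, (1 - dip n M S μ R β (x - unitVec (fine n M) κ))
          - 2 * ∏ β : Tor M, (1 - dip n M S μ R β x)) by ring, abs_neg]
  refine (abs_prod_second_le _ (fun β _ => one_sub_dip_mem hR hn β _) (fun β _ => one_sub_dip_mem hR hn β _)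
    (fun β _ => one_sub_dip_mem hR hn β _)).trans ?_
  have h2 := sum_abs_dip_second_le hR hn κ hx hp hm hnc
  have hf := sum_abs_dip_step_le hR hn κ hx hp hnc
  have hh : ∑ β : Tor M, |(1 - dip n M S μ R β (x - unitVec (fine n M) κ)) - (1 - dip n M S μ R β x)| ≤ ell1 d R := by
    have := sum_abs_dip_step_le hR hn κ hm (by rw [sub_add_cancel]; exact hx) hncm
    simp only [sub_add_cancel] at this
    calc ∑ β : Tor M, |(1 - dip n M S μ R β (x - unitVec (fine n M) κ)) - (1 - dip n M S μ R β x)|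
        = ∑ β : Tor M, |(1 - dip n M S μ R β x) - (1 - dip n M S μ R β (x - unitVec (fine n M) κ))| :=
          Finset.sum_congr rfl fun β _ => abs_sub_comm _ _
      _ ≤ ell1 d R := this
  have he1 : 0 ≤ ell1 d R := by unfold ell1; positivity
  have hS0 : 0 ≤ ∑ β : Tor M, |(1 - dip n M S μ R β (x + unitVec (fine n M) κ)) - (1 - dip n M S μ R β x)| :=
    Finset.sum_nonneg fun _ _ => abs_nonneg _
  have hS1 : 0 ≤ ∑ β : Tor M, |(1 - dip n M S μ R β (x - unitVec (fine n M) κ)) - (1 - dip n M S μ R β x)| :=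
    Finset.sum_nonneg fun _ _ => abs_nonneg _
  unfold ell2
  nlinarith [pow_le_pow_left₀ hS0 hf 2, pow_le_pow_left₀ hS1 hh 2]

/-- **THE INTRINSIC SMOOTHNESS STRUCTURE OF `ψ_μ`** (file 1's `RelSmoothIn`): for every field `z` whose support keeps the corner cells of the
`−μ`-exposed blocks at distance `1` (`z x ≠ 0 ∨ z(x ± e_ν) ≠ 0` forces `x, x ± e_ν ∉ NearCorner β`), every `S`, every `d`, every torus,
`2 ≤ R`, `4R ≤ n`. [folklore] -/
theorem psiS_relSmoothIn {z : Tor (fine n M) → ℂ}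
    (hfar : ∀ x (ν : Fin d), (z x ≠ 0 ∨ z (x + unitVec (fine n M) ν) ≠ 0 ∨ z (x - unitVec (fine n M) ν) ≠ 0) →
      ∀ β, BotExp M S μ β → ¬ NearCorner n M μ R β x ∧ ¬ NearCorner n M μ R β (x + unitVec (fine n M) ν)
        ∧ ¬ NearCorner n M μ R β (x - unitVec (fine n M) ν)) :
    RelSmoothIn (fine n M) (blockReg n M S) z (psiS n M S μ R) (ell1 d R) (ell2 d R) where
  nonneg x := (DirichletDipCutoff.psiS_mem hR hn x).1
  le_one x := (DirichletDipCutoff.psiS_mem hR hn x).2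
  ell1_nonneg := by have := lip1_nonneg hR; unfold ell1; positivity
  ell2_nonneg := by have := lip1_nonneg hR; have : 0 ≤ lip2 R := lip2_nonneg; unfold ell2 ell1; positivity
  lip x ν hx hz := by
    have h := hfar x ν hz
    refine ⟨fun hy => psiS_step hR hn ν hx hy (fun β hβ => (h β hβ).1), fun hy => ?_⟩
    have := psiS_step hR hn ν hy (by rw [sub_add_cancel]; exact hx) (fun β hβ => (h β hβ).2.2)
    rw [sub_add_cancel] at this
    exact this
  lip₂ x ν hx hp hm hz := psiS_second hR hn ν hx hp hm (fun β hβ => (hfar x ν hz β hβ).1) (fun β hβ => (hfar x ν hz β hβ).2.2)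

end Main

end Summit.QuantumFields.BalabanUV.T4Continuum.DirichletDipCutoffSmooth

end
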